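import Summits.QuantumFields.YangMills.Theorems.BalabanUVNodesK0RecordFormatNamesLemmas2
import Literature.MathematicalPhysics.QuantumFieldTheory.Balaban1983to89.B12BetaHolo
import Literature.MathematicalPhysics.QuantumFieldTheory.Balaban1983to89.Node00.U3KernelLetters

/-!
# K0⁷ record FORMAT⁺ names — lemma file 3: the faces and joins of §18 «Π-HOLOMORPHY AT THE RECORD» (port-lead LEDGER v1.4, T-3 = PT-H)

Companion of `…BalabanUVNodesK0RecordFormatNames` §18 (names EDITION 9).  Kernel-checked bookkeeping, nothing of Bałaban's asserted:

* §1 faces (`rfl`): the record's term family IS the object `recordΦf` charts and `PolLimitsExistOfRecord₁₃ (thetaFill …)` quantifies over;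
  `recordPlim` along a sequence IS `Node00.U3OfKernels.kernelA`; `recordPvol → recordPlim` under `PolLimitExists`; `recordPk` at the history's own
  last coupling IS `recordPlim`; `recordPk … t 0 1 z = (recordPℓ … t z).re`; the pair `(0, 1)` is off-diagonal; ROW W for the pair labels; the
  (5.42) flow's fields.
* §2 the β of record at `thetaFill`: ON THE BOX `]0, ½]^{k+1}` it IS the (1.22)-moment of `recordPlim` ∕ of `recordPk` at the last coupling ∕ the
  (5.42) flow of record; and **θ-BLINDNESS** (`rfl`): `betaOfRecord₁₃` at stub 2′'s witness `theta13OfThm1CCMWZB F 2 j ½ a₀ ε₀ ε₂₉ B₃ B₃' a₀ a₁ 0 0`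
  IS `betaOfRecord₁₃ (thetaFill F a₀ ε₂₉)` — 2′'s letters `j, ε₀, B₃, B₃', a₁` are unread by β.
* §3 the JOIN with `B12BetaHolo`: `RecordPiHoloAt … k v U c.γ C δ₁` + a tower whose `β_{k+1}` is (5.42) of `recordPk … k v` on `[0, γ]` + `β′₅.₁₀ ≤ c.β'`
  ⟹ `Nonempty (PiHoloSource T c k)` (fields BY NAME: `d := 4`, `(μ, ν) := (0, 1)`, `Pk := recordPk`); for a tower carrying `recordBetaFlow` the
  `beta_eq` premise is `rfl`; hence `PiHoloSource.betaBound` at the record.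
* §4 TOWER-FREE: `RecordPiHoloAt` ⟹ (5.10) for the real kernel on `[0, γ]` ⟹ `|Σ_x Π^{(k+1)}_{01}(t, x) x₀x₁| ≤ β′₅.₁₀`; `RecordPiHoloUniform … γ r C δ₁`, `γ ≤ ½`
  ⟹ `BetaUpperH β′₅.₁₀ γ β ∧ BetaLowerH (−β′₅.₁₀) γ β` for `β := betaOfRecord₁₃ (thetaFill …)` AND for `β :=` 2′'s `betaOfRecord₁₃ (theta13OfThm1CCMWZB …)`.

HONEST FRAMING.  Helper lemmas about DEF-1's names (count-neutral); no port text is closed here; stub 2′ OPEN; K0⁷ NOT closed; NODE O not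
inhabited; finite 𝕋⁴ at fixed ε — not continuum ∕ OS ∕ Clay; the Yang–Mills mass gap is NOT proved by any of this.
-/

noncomputable section

open scoped BigOperators Matrix.Norms.L2Operator Topology
open Set Filter

namespace Summit.QuantumFields.YangMills.Theorems.K0RecordFormatNames

open Literature.MathematicalPhysics.QuantumFieldTheory.Balaban1983to89
open Literature.MathematicalPhysics.QuantumFieldTheory.Balaban1983to89.Node00
open Literature.MathematicalPhysics.QuantumFieldTheory.Balaban1983to89.T4Continuum (T4Family)
open Literature.MathematicalPhysics.QuantumFieldTheory.Balaban1983to89.Step (SFTower SFConsts)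
open Literature.MathematicalPhysics.QuantumFieldTheory.Balaban1983to89.B12BetaHolo (PiHoloSource nonempty_piHoloSource)
open Literature.MathematicalPhysics.QuantumFieldTheory.Balaban1983to89.T4OutputRate (Window)
open Literature.MathematicalPhysics.QuantumFieldTheory.Balaban1983to89.Node00.U3OfKernels (kernelA histPrefix)
open Literature.MathematicalPhysics.QuantumFieldTheory.Balaban1983to89.Node00.U3KernelLetters (PolLimitsExistOfRecord₁₃)

variable (F : T4Family) (a₀ ε₂₉ : ℝ)

/-! ## §1  Faces of the §18 names -/

/-- The term family §18 reads IS the one `recordΦf` (§9) charts (`rfl`). [cite: Balaban1987RG1, (1.6) p.261, (1.20) p.264 (bookkeeping)] -/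
theorem recordΦf_eq_expChart_recordTerms (k : ℕ) (v : Fin (k + 1) → ℝ) (K : ℕ) (B : recordW F a₀ ε₂₉ k K) :
    recordΦf F a₀ ε₂₉ k v K B =
      (letI θ := thetaFill F a₀ ε₂₉
       letI := θ.instVβ₁; letI := θ.instVβ₂
       ((B12PolarizationTensor120.expChart (recordTerms F a₀ ε₂₉ k v K) θ.ρ8 B : ℝ) : ℂ)) := rfl

/-- The (1.21)-existence letter of record AT `thetaFill` quantifies over exactly the §18 term family (`Iff.rfl`). [cite: Balaban1987RG1, (1.21) p.264 (bookkeeping)] -/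
theorem polLimitsExistOfRecord₁₃_thetaFill_iff :
    PolLimitsExistOfRecord₁₃ F 2 (thetaFill F a₀ ε₂₉) ↔
      (letI θ := thetaFill F a₀ ε₂₉
       letI := θ.instVβ₁; letI := θ.instVβ₂; letI := θ.instιβ
       ∀ w ∈ Window (1 / 2 : ℝ), ∀ k : ℕ, PolLimitExists F (k + 1) (fun K => recordTerms F a₀ ε₂₉ k (histPrefix w k) K) θ.ρ8 θ.bV) :=
  Iff.rfl

/-- Along a coupling sequence the §18 limiting kernel IS `kernelA` of the record's term family (`rfl`). [cite: Balaban1987RG1, (1.21) p.264 (bookkeeping)] -/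
theorem recordPlim_histPrefix_eq_kernelA (w : ℕ → ℝ) (k : ℕ) :
    recordPlim F a₀ ε₂₉ k (histPrefix w k) =
      (letI θ := thetaFill F a₀ ε₂₉
       letI := θ.instVβ₁; letI := θ.instVβ₂; letI := θ.instιβ
       kernelA F (recordTerms F a₀ ε₂₉) θ.ρ8 θ.bV w k) := rfl

/-- Unfolding `recordPvol` (`rfl`). [cite: Balaban1987RG1, (1.20)–(1.21) p.264 (bookkeeping)] -/
theorem recordPvol_apply (k : ℕ) (v : Fin (k + 1) → ℝ) (K : ℕ) (μ ν : Fin 4) (z : Fin 4 → ℤ) :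
    recordPvol F a₀ ε₂₉ k v K μ ν z =
      (letI θ := thetaFill F a₀ ε₂₉
       letI := θ.instVβ₁; letI := θ.instVβ₂; letI := θ.instιβ
       polWindow F K (k + 1) (recordTerms F a₀ ε₂₉ k v K) θ.ρ8 θ.bV μ ν z) := rfl

/-- **(1.21) at the record under the existence letter**: the finite-volume kernels converge to `recordPlim` (typer-1's `Limit121` at the record).
[cite: Balaban1987RG1, (1.21) p.264] -/
theorem tendsto_recordPvol (k : ℕ) (v : Fin (k + 1) → ℝ)
    (h : letI θ := thetaFill F a₀ ε₂₉
      letI := θ.instVβ₁; letI := θ.instVβ₂; letI := θ.instιβ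
      PolLimitExists F (k + 1) (fun K => recordTerms F a₀ ε₂₉ k v K) θ.ρ8 θ.bV)
    (μ ν : Fin 4) (z : Fin 4 → ℤ) :
    Tendsto (fun K => recordPvol F a₀ ε₂₉ k v K μ ν z) atTop (𝓝 (recordPlim F a₀ ε₂₉ k v μ ν z)) := by
  letI θ := thetaFill F a₀ ε₂₉
  letI := θ.instVβ₁; letI := θ.instVβ₂; letI := θ.instιβ
  exact tendsto_polLimit F (k + 1) _ _ _ h μ ν z

/-- Unfolding `recordPk` (`rfl`). [cite: Balaban1987RG1, (5.42) p.297 (bookkeeping)] -/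
theorem recordPk_apply (k : ℕ) (v : Fin (k + 1) → ℝ) (t : ℝ) :
    recordPk F a₀ ε₂₉ k v t = recordPlim F a₀ ε₂₉ k (Function.update v (Fin.last k) t) := rfl

/-- At the history's OWN last coupling the kernel family returns the limiting kernel of that history. [cite: Balaban1987RG1, (1.21)–(1.22) p.264 (bookkeeping)] -/
theorem recordPk_last (k : ℕ) (v : Fin (k + 1) → ℝ) :
    recordPk F a₀ ε₂₉ k v (v (Fin.last k)) = recordPlim F a₀ ε₂₉ k v := by
  simp only [recordPk, Function.update_eq_self]

/-- The real kernel's `(0, 1)`-component is the real part of `recordPℓ`. [cite: Balaban1987RG1, (1.21) p.264 (bookkeeping)] -/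
theorem recordPk_eq_re_recordPℓ (k : ℕ) (v : Fin (k + 1) → ℝ) (t : ℝ) (z : Fin 4 → ℤ) :
    recordPk F a₀ ε₂₉ k v t 0 1 z = (recordPℓ F a₀ ε₂₉ k v t z).re := by
  simp only [recordPℓ, Complex.ofReal_re]

/-- The pair `(μ, ν) = (0, 1)` of §18 is OFF-DIAGONAL, as (1.22) demands («μ ≠ ν»). [cite: Balaban1987RG1, (1.22) p.264] -/
theorem recordPair_ne : (0 : Fin 4) ≠ 1 := by decide

/-- ROW W for the pair labels: inside the window the label metric of (origin label, running label at `z`) is `|z|₁`. [cite: Balaban1987RG1, (1.21) p.264, (5.10) p.293] -/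
theorem recordRho_recordLabel_window (k K : ℕ) (z : Fin 4 → ℤ) (hz : ∀ i, 2 * |z i| < (recordN F k K : ℤ)) :
    recordRho F k K (recordLabel₀ F k K) (recordLabel₁ F k K z) = B12Sec2to5.l1 z :=
  recordRho_recordE_window F k K 0 1 z hz

/-- The cut response IS typer-1's `cutTo (R.cX n X) (R.Gk n y)` at the record data (`rfl`). [cite: Balaban1987RG1, (4.35) p.290 (bookkeeping)] -/
theorem recordHn_eq (Mc k K : ℕ) (X : (recordDomSys F Mc k K).Dom) (l : RespLabel F k K) :
    recordHn F a₀ ε₂₉ Mc k K X l =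
      B12FormatPlus.cutTo (recordCXJ F Mc k K X) (recordGkJ F (thetaFill F a₀ ε₂₉) k K (recordAStar F a₀ ε₂₉) l) := rfl

/-- The (5.42) flow's couplings (`rfl`). [cite: Balaban1987RG1, (0.20) p.256 (bookkeeping)] -/
theorem recordBetaFlow_g (w : ℕ → ℝ) : (recordBetaFlow F a₀ ε₂₉ w).g = w := rfl

/-- The (5.42) flow's `β_{k+1}` IS (1.22) of the record's kernel family at the earlier history `w₀, …, w_{k−1}` (`rfl`) — the `beta_eq` field of
`PiHoloSource` for any tower carrying this flow. [cite: Balaban1987RG1, (5.42) p.297, (1.22) p.264] -/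
theorem recordBetaFlow_beta_succ (w : ℕ → ℝ) (k : ℕ) (t : ℝ) :
    (recordBetaFlow F a₀ ε₂₉ w).β (k + 1) t = B12Beta.secondMoment (recordPk F a₀ ε₂₉ k (FlowStep.prefixOf w k) t) 0 1 := rfl

/-! ## §2  The β of record at `thetaFill`: on the box, and θ-blindness -/

/-- **Unfolding the β of record at `thetaFill`** (`rfl`): the box convention `β⁰ + 𝟙_{]0,½]^{k+1}}·(β_merged − β⁰)` over the §18 term family.
[cite: Balaban1987RG1, (1.22) p.264, (2.12)–(2.14) p.268] -/
theorem betaOfRecord₁₃_thetaFill_eq (k : ℕ) (v : Fin (k + 1) → ℝ) :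
    betaOfRecord₁₃ F 2 (thetaFill F a₀ ε₂₉) k v =
      (letI θ := thetaFill F a₀ ε₂₉
       letI := θ.instVβ₁; letI := θ.instVβ₂; letI := θ.instιβ
       betaOfMerged (betaMerged F (recordTerms F a₀ ε₂₉) θ.ρ8 θ.bV)
        (beta0OfMerged (betaMerged F (recordTerms F a₀ ε₂₉) θ.ρ8 θ.bV) θ.v₀) (1 / 2) k v) := rfl

/-- **ON THE BOX the β of record IS the (1.22)-moment of the §18 limiting kernel.** [cite: Balaban1987RG1, (1.22) p.264] -/
theorem betaOfRecord₁₃_thetaFill_of_mem_box {k : ℕ} {v : Fin (k + 1) → ℝ} (hv : v ∈ FlowStep.Box (1 / 2) k) :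
    betaOfRecord₁₃ F 2 (thetaFill F a₀ ε₂₉) k v = B12Beta.secondMoment (recordPlim F a₀ ε₂₉ k v) 0 1 := by
  rw [betaOfRecord₁₃_thetaFill_eq, betaOfMerged_of_mem _ _ _ hv]
  rfl

/-- … equivalently of the kernel family `recordPk` at the history's last coupling. [cite: Balaban1987RG1, (5.42) p.297] -/
theorem betaOfRecord₁₃_thetaFill_eq_secondMoment_recordPk {k : ℕ} {v : Fin (k + 1) → ℝ} (hv : v ∈ FlowStep.Box (1 / 2) k) :
    betaOfRecord₁₃ F 2 (thetaFill F a₀ ε₂₉) k v = B12Beta.secondMoment (recordPk F a₀ ε₂₉ k v (v (Fin.last k))) 0 1 := by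
  rw [recordPk_last, betaOfRecord₁₃_thetaFill_of_mem_box F a₀ ε₂₉ hv]

/-- … equivalently the value of the (5.42) flow of record along any sequence `w` extending the history. [cite: Balaban1987RG1, (5.42) p.297, (0.20) p.256] -/
theorem betaOfRecord₁₃_thetaFill_eq_recordBetaFlow (w : ℕ → ℝ) {k : ℕ} (hv : FlowStep.prefixOf w k ∈ FlowStep.Box (1 / 2) k) :
    betaOfRecord₁₃ F 2 (thetaFill F a₀ ε₂₉) k (FlowStep.prefixOf w k) = (recordBetaFlow F a₀ ε₂₉ w).β (k + 1) (w k) :=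
  betaOfRecord₁₃_thetaFill_eq_secondMoment_recordPk F a₀ ε₂₉ hv

/-- **θ-BLINDNESS OF β (`rfl`)**: the β of record at stub 2′'s witness `theta13OfThm1CCMWZB F 2 j ½ a₀ ε₀ ε₂₉ B₃ B₃' a₀ a₁ 0 0` IS the β of record at
`thetaFill F a₀ ε₂₉` — the letters `j, ε₀, B₃, B₃', a₁` are not read by β (they enter the Stage-7 numerics only). [cite: Balaban1987RG1, (1.20)–(1.22) p.264 (bookkeeping)] -/
theorem betaOfRecord₁₃_thm1Witness_eq_thetaFill (j : ℕ) (ε₀ B₃ B₃' a₁ : ℝ) :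
    betaOfRecord₁₃ F 2 (theta13OfThm1CCMWZB F 2 j (1 / 2) a₀ ε₀ ε₂₉ B₃ B₃' a₀ a₁ (fun _ _ => 0) (fun _ _ => 0)) =
      betaOfRecord₁₃ F 2 (thetaFill F a₀ ε₂₉) := rfl

/-- Box monotonicity in the window parameter. [folklore] -/
theorem box_mono {γ γ' : ℝ} (h : γ ≤ γ') {k : ℕ} {v : Fin (k + 1) → ℝ} (hv : v ∈ FlowStep.Box γ k) : v ∈ FlowStep.Box γ' k := by
  rw [FlowStep.mem_box] at hv ⊢
  exact fun i => ⟨(hv i).1, (hv i).2.trans h⟩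

/-! ## §3  The join with `B12BetaHolo.PiHoloSource` -/

section Join

variable {P : Params} {G : Type*} [GaugeGroup G] {Φ 𝒢 : Type*}

/-- **`PiHoloSource` AT THE RECORD, FIELDS BY NAME**: Π-holomorphy at the record (step `k`, earlier history in `v`, on `U ⊇ [0, c.γ]`), a tower whose
`β_{k+1}` is (5.42) of `recordPk … k v` on `[0, c.γ]`, and `β′₅.₁₀ = betaPrime510 4 C δ₁ ≤ c.β'` give `Nonempty (PiHoloSource T c k)` with `d := 4`,
`(μ, ν) := (0, 1)`, `Pk := recordPk F a₀ ε₂₉ k v`. [cite: Balaban1987RG1, (5.10) p.293, (5.42) p.297, p.266 (analytic alternative)] -/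
theorem piHoloSource_of_recordPiHoloAt {T : SFTower P G Φ 𝒢} {c : SFConsts} {k : ℕ} {v : Fin (k + 1) → ℝ} {U : Set ℂ} {C δ₁ : ℝ}
    (h : RecordPiHoloAt F a₀ ε₂₉ k v U c.γ C δ₁)
    (hβ : ∀ t, 0 ≤ t → t ≤ c.γ → T.flow.β (k + 1) t = B12Beta.secondMoment (recordPk F a₀ ε₂₉ k v t) 0 1)
    (hle : B12Sec2to5.betaPrime510 4 C δ₁ ≤ c.β') : Nonempty (PiHoloSource T c k) := by
  obtain ⟨hU, hIU, hδ, Pc, hPc, hdec, hre⟩ := h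
  exact nonempty_piHoloSource 0 1 (recordPk F a₀ ε₂₉ k v) hβ hU hIU Pc hPc hδ hdec hre hle

/-- **… for a tower CARRYING THE (5.42) FLOW OF RECORD the `beta_eq` premise is automatic** (`rfl` field by field). [cite: Balaban1987RG1, (5.42) p.297] -/
theorem piHoloSource_of_recordPiHoloAt_of_flow {T : SFTower P G Φ 𝒢} {c : SFConsts} {k : ℕ} (w : ℕ → ℝ)
    (hT : T.flow = recordBetaFlow F a₀ ε₂₉ w) {U : Set ℂ} {C δ₁ : ℝ}
    (h : RecordPiHoloAt F a₀ ε₂₉ k (FlowStep.prefixOf w k) U c.γ C δ₁) (hle : B12Sec2to5.betaPrime510 4 C δ₁ ≤ c.β') :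
    Nonempty (PiHoloSource T c k) :=
  piHoloSource_of_recordPiHoloAt F a₀ ε₂₉ h (fun t _ _ => by rw [hT]; rfl) hle

/-- **Hence the β-BOUND of the Theorem-3 step at the record** (`PiHoloSource.betaBound`): `|β_{k+1}(t)| ≤ β'` on `[0, γ]` for the tower's flow.
[cite: Balaban1987RG1, p.264 (Thm 3 β-clause «uniformly bounded»)] -/
theorem abs_flow_beta_le_of_recordPiHoloAt {T : SFTower P G Φ 𝒢} {c : SFConsts} {k : ℕ} {v : Fin (k + 1) → ℝ} {U : Set ℂ} {C δ₁ : ℝ}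
    (h : RecordPiHoloAt F a₀ ε₂₉ k v U c.γ C δ₁)
    (hβ : ∀ t, 0 ≤ t → t ≤ c.γ → T.flow.β (k + 1) t = B12Beta.secondMoment (recordPk F a₀ ε₂₉ k v t) 0 1)
    (hle : B12Sec2to5.betaPrime510 4 C δ₁ ≤ c.β') : ∀ t ∈ Set.Icc (0 : ℝ) c.γ, |T.flow.β (k + 1) t| ≤ c.β' := by
  obtain ⟨S⟩ := piHoloSource_of_recordPiHoloAt F a₀ ε₂₉ h hβ hle
  exact S.betaBound

end Join

/-! ## §4  Tower-free: (5.10) for the real kernel, the (1.22)-bound, and the β-box of record (stub 2′'s shape) -/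

/-- **(5.10) ON `[0, γ]` FOR THE RECORD's REAL KERNEL** from Π-holomorphy at the record (`|Re Pc| ≤ ‖Pc‖`). [cite: Balaban1987RG1, (5.10) p.293] -/
theorem decay510_recordPk_of_recordPiHoloAt {k : ℕ} {v : Fin (k + 1) → ℝ} {U : Set ℂ} {γ C δ₁ : ℝ}
    (h : RecordPiHoloAt F a₀ ε₂₉ k v U γ C δ₁) {t : ℝ} (ht : t ∈ Set.Icc (0 : ℝ) γ) :
    B12Sec2to5.Decay510 (recordPk F a₀ ε₂₉ k v t 0 1) C δ₁ := by
  obtain ⟨-, hIU, -, Pc, -, hdec, hre⟩ := h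
  intro z
  rw [hre z t ht]
  exact (Complex.abs_re_le_norm _).trans (hdec z t (hIU t ht))

/-- **THE (1.22)-BOUND AT THE RECORD, tower-free**: `|Σ_x Π^{(k+1)}_{01}(t, x) x₀ x₁| ≤ β′₅.₁₀ = betaPrime510 4 C δ₁` on `[0, γ]`.
[cite: Balaban1987RG1, p.264 (β-clause), (5.10) p.293, (5.42) p.297] -/
theorem abs_secondMoment_recordPk_le {k : ℕ} {v : Fin (k + 1) → ℝ} {U : Set ℂ} {γ C δ₁ : ℝ}
    (h : RecordPiHoloAt F a₀ ε₂₉ k v U γ C δ₁) {t : ℝ} (ht : t ∈ Set.Icc (0 : ℝ) γ) :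
    |B12Beta.secondMoment (recordPk F a₀ ε₂₉ k v t) 0 1| ≤ B12Sec2to5.betaPrime510 4 C δ₁ :=
  (B12Sec2to5.secondMoment_abs_le_of_decay510 h.2.2.1 (decay510_recordPk_of_recordPiHoloAt F a₀ ε₂₉ h ht)).2

/-- **THE β-BOX OF RECORD FROM UNIFORM Π-HOLOMORPHY** (stub 2′'s two conjuncts at `thetaFill`): for `γ ≤ ½`,
`BetaUpperH β′₅.₁₀ γ (betaOfRecord₁₃ F 2 (thetaFill F a₀ ε₂₉)) ∧ BetaLowerH (−β′₅.₁₀) γ (betaOfRecord₁₃ F 2 (thetaFill F a₀ ε₂₉))`.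
[cite: Balaban1987RG1, p.264 (Thm 3 β-clause), (5.10) p.293, (1.22) p.264] -/
theorem betaBox_thetaFill_of_recordPiHoloUniform {γ r C δ₁ : ℝ} (hγ : γ ≤ 1 / 2) (h : RecordPiHoloUniform F a₀ ε₂₉ γ r C δ₁) :
    FlowStep.BetaUpperH (B12Sec2to5.betaPrime510 4 C δ₁) γ (betaOfRecord₁₃ F 2 (thetaFill F a₀ ε₂₉)) ∧
      FlowStep.BetaLowerH (-B12Sec2to5.betaPrime510 4 C δ₁) γ (betaOfRecord₁₃ F 2 (thetaFill F a₀ ε₂₉)) := by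
  have key : ∀ (k : ℕ) (v : Fin (k + 1) → ℝ), v ∈ FlowStep.Box γ k →
      |betaOfRecord₁₃ F 2 (thetaFill F a₀ ε₂₉) k v| ≤ B12Sec2to5.betaPrime510 4 C δ₁ := by
    intro k v hv
    have hlast : v (Fin.last k) ∈ Set.Icc (0 : ℝ) γ :=
      ⟨(FlowStep.mem_box.1 hv (Fin.last k)).1.le, (FlowStep.mem_box.1 hv (Fin.last k)).2⟩
    rw [betaOfRecord₁₃_thetaFill_eq_secondMoment_recordPk F a₀ ε₂₉ (box_mono hγ hv)]
    exact abs_secondMoment_recordPk_le F a₀ ε₂₉ (h.2 k v hv) hlast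
  exact ⟨fun k v hv => (le_abs_self _).trans (key k v hv),
    fun k v hv => (neg_le_neg (key k v hv)).trans (neg_abs_le _)⟩

/-- **… AND AT STUB 2′'s OWN WITNESS** (θ-blindness): the same box for `betaOfRecord₁₃ F 2 (theta13OfThm1CCMWZB F 2 j ½ a₀ ε₀ ε₂₉ B₃ B₃' a₀ a₁ 0 0)` — the two
`BetaLowerH ∕ BetaUpperH` conjuncts of `K0V23Defs.AbsBetaBoxAtThm1WitnessCCMGenGridGZBAt` at `γ₀ := γ`, `β' := β′₅.₁₀`.
[cite: Balaban1987RG1, p.264 (Thm 3 β-clause), (5.10) p.293] -/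
theorem betaBox_thm1Witness_of_recordPiHoloUniform {γ r C δ₁ : ℝ} (hγ : γ ≤ 1 / 2) (h : RecordPiHoloUniform F a₀ ε₂₉ γ r C δ₁)
    (j : ℕ) (ε₀ B₃ B₃' a₁ : ℝ) :
    FlowStep.BetaLowerH (-B12Sec2to5.betaPrime510 4 C δ₁) γ
        (betaOfRecord₁₃ F 2 (theta13OfThm1CCMWZB F 2 j (1 / 2) a₀ ε₀ ε₂₉ B₃ B₃' a₀ a₁ (fun _ _ => 0) (fun _ _ => 0))) ∧
      FlowStep.BetaUpperH (B12Sec2to5.betaPrime510 4 C δ₁) γ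
        (betaOfRecord₁₃ F 2 (theta13OfThm1CCMWZB F 2 j (1 / 2) a₀ ε₀ ε₂₉ B₃ B₃' a₀ a₁ (fun _ _ => 0) (fun _ _ => 0))) := by
  rw [betaOfRecord₁₃_thm1Witness_eq_thetaFill]
  exact ⟨(betaBox_thetaFill_of_recordPiHoloUniform F a₀ ε₂₉ hγ h).2, (betaBox_thetaFill_of_recordPiHoloUniform F a₀ ε₂₉ hγ h).1⟩

end Summit.QuantumFields.YangMills.Theorems.K0RecordFormatNames

end
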